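import Literature.AlgebraicGeometry.HodgeTheory.UnitaryTwoOneTimesCMCurveSquareCodimTwo
import HarnessLib

/-!
# `T × S`, `T` a `(2,1)`-threefold, `S` with abelian Hodge-commutant: the one-slot invariance theorem with the SHARPENED
# word dichotomy «`T`-kind balanced, OR one letter per `T`-pair with `T`-kind weight `±1`» (Moonen–Zarhin 1999 §5 (5.3), (5.11))

Family `hodge`, layer `Literature/AlgebraicGeometry/HodgeTheory`. Written for the cell `pub-hodgeav-hg6` (LADDER-HodgeAV row 2,
TABLE X row 21 `g6.E3xY3.(2,1)`, census programme γ2, brick γ2-D(i), eng-2 g6; honest framing of that cell: HC / HC_AV / HC_CM NOT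
proved — THIS file is UNCONDITIONAL). Theorems only (no definition, no named fact, D-0026; nothing admitted). It is a COPY of §1
and §3 of the tree's `UnitaryTwoOneTimesCMCurveSquareCodimTwo` (programme R41) with ONE sharpening of the exported conclusion:
R41's word-combinatorial core proves that the signed `W`-contents `c_ℓ` of a root-difference-killed word are all equal to a common
`c ∈ {-1, 0, 1}` and that the `T`-kind weight IS `c` (because `#{κ = 0} - #{κ = 1} = 1`), but exports only «kind weight `0`, or
one letter from each `T`-pair»; the second alternative as exported still admits the one-per-pair words whose three `T`-letters are
ALL of type `(1,0)` (kind weight `3`: the `(3,0)`-monomial of `∧²W ⊗ W̄`) or all of type `(0,1)`. For the codimension-THREE analysis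
of `T × E³` (brick γ2-D(ii): the `T`-degree-`3` Künneth component must pair `H^{2,1} ⊕ H^{1,2}(T)` with `H^{1,2} ⊕ H^{2,1}(E³)`)
those words must be excluded, which the root-difference weights do. Hence:
* §1 `kindWeight_eq_zero_or_card_isLeft_eq_and_unit_of_rootDiffWeights` — R41 §1 with the conclusion «kind weight `0` ∨ (one
  letter per pair ∧ kind weight `= ±1`)» (same proof plus `|c| ≤ 1`, `c ≠ 0`).
* §2 `AVSlots.exists_coeff_eq_zero_off_balanced_or_unitPair_of_prod_unitaryTwoOne_abelianCommutant` — R41 §3 VERBATIM (one slot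
  over `T × S`, `S` ANY abelian variety with abelian Hodge-commutant `hSc`; Lie step
  `Motives/HodgeThetaAnnihilatorUnitaryTimesAbelianCommutant`) with the sharpened third conjunct.
Nothing else is changed or claimed; codimension two (R41 §5, `UnitaryTwoOneTimesCMCurveCubeCodimTwo`) does not need the sharpening.

## References
* [MoonenZarhin1999LowDim] B. Moonen, Yu. Zarhin, Math. Ann. 315 (1999), Thm. 0.2 (1) with case (e), §5 (5.3), (5.11).
* [Deligne1982HodgeCycles] P. Deligne, LNM 900 (1982), I §3 Prop. 3.4.
* [Lombardo2016] D. Lombardo, Ann. Inst. Fourier 66 (2016), Lemma 3.4 (p. 1229).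
* [Ribet1983] K. Ribet, Amer. J. Math. 105 (1983), Thm. 3.
* [GoodmanWallachGTM255] R. Goodman, N. Wallach, GTM 255, §4.1.1.
-/

noncomputable section

open scoped TensorProduct
open CategoryTheory Module

namespace Literature.AlgebraicGeometry.HodgeTheory

open Literature.AlgebraicTopology.SingularHomology
open Literature.AlgebraicGeometry.Motives (IsSmoothProjective AbelianVariety bettiCohomology
  ofRatClassBaseChange ofRatClassBaseChange_tmul HodgeTensorFacts hodgeTensorFacts_holds ComplexPoints)
open Literature.Barriers.HodgeConjecture
open Literature.AlgebraicGeometry.Motives.HodgeStructure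
open Literature.AlgebraicGeometry.ComplexMultiplication
open Literature.RepresentationTheory.GeneralLinear
open Literature.NumberTheory.DiophantineGeometry

/-! ### §1 The sharpened word-combinatorial core -/

section Combinatorics

variable {hY h d : ℕ}

/-- `∑_t (±1 by kind) = #(kind 0) - #(kind 1)` over any finset of positions. [folklore] -/
private theorem sum_kindSign_eq_card_sub_card_shp (s : Finset (Fin d)) (η : Fin d → Fin 2) :
    ∑ t ∈ s, (if η t = 0 then (1 : ℤ) else -1) =
      ((s.filter fun t => η t = 0).card : ℤ) - ((s.filter fun t => η t = 1).card : ℤ) := by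
  rw [Finset.card_filter, Finset.card_filter, Nat.cast_sum, Nat.cast_sum, ← Finset.sum_sub_distrib]
  refine Finset.sum_congr rfl fun t _ => ?_
  rcases Fin.exists_fin_two.1 ⟨η t, rfl⟩ with h0 | h1
  · simp [h0]
  · simp [h1]

/-- In `Fin 2`, `x ≠ r` forces `x = 1 - r`. [folklore] -/
private theorem fin2_eq_one_sub_of_ne_shp : ∀ {x r : Fin 2}, x ≠ r → x = 1 - r := by decide

/-- In `Fin 2`, `1 - r ≠ r`. [folklore] -/
private theorem fin2_one_sub_ne_shp : ∀ r : Fin 2, 1 - r ≠ r := by decide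

/-- The two elements of `Fin 2`. [folklore] -/
private theorem fin2_eq_zero_or_one_shp (r : Fin 2) : r = 0 ∨ r = 1 := by
  fin_cases r <;> simp

/-- In a word without repeated letters, at most one position carries a given letter `(place, kind)`. [folklore] -/
private theorem card_filter_place_kind_le_one_shp (P : Fin d → Fin hY ⊕ Fin h) (η : Fin d → Fin 2)
    (hinj : Function.Injective fun t => (P t, η t)) (q : Fin hY ⊕ Fin h) (r : Fin 2) :
    (Finset.univ.filter fun t => P t = q ∧ η t = r).card ≤ 1 := by
  refine Finset.card_le_one.2 fun t ht t' ht' => ?_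
  have h1 := (Finset.mem_filter.1 ht).2
  have h2 := (Finset.mem_filter.1 ht').2
  exact hinj (Prod.ext (h1.1.trans h2.1.symm) (h1.2.trans h2.2.symm))

/-- **The word-combinatorial core for multiplicities `(2,1)` next to an arbitrary number of further pairs — the
dichotomy** (Moonen–Zarhin §5 (5.12) with (5.3): «`Hg(X) ⊃ {1} × SU_{F/k}(V₂,ψ)`» on ONE copy of
`H¹(T) ⊕ H¹(S)`). Places `Fin hY ⊕ Fin h` (`h` ARBITRARY: the pairs of `H¹(S)`), kinds `κ` of the `T`-pairs with
`#{κ = 0} = #{κ = 1} + 1`, a word `t ↦ (P t, η t)` WITHOUT REPEATED LETTERS killed by every root-difference weight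
`E_ii - E_jj` of `𝔰𝔩(W)` (`W`-sign `+1` iff `η t = κ ℓ`; the `S`-letters have weight `0`). Then EITHER its `T`-kind
weight vanishes, OR the word carries EXACTLY ONE letter from every `T`-pair — so that its number of `T`-positions is
`hY` — AND its `T`-kind weight is `±1` (SHARPENED form of the tree's `kindWeight_eq_zero_or_card_isLeft_eq_of_rootDiffWeights`:
the common signed content `c = ±1` IS the kind weight, since `#{κ=0} - #{κ=1} = 1`; this excludes the one-per-pair words whose
`T`-letters are all of type `(1,0)` or all of type `(0,1)`). Proof: the signed contents `c_ℓ = n⁺_ℓ - n⁻_ℓ ∈ {-1,0,1}` (`n^±_ℓ ≤ 1`) have a common value `c`, the `T`-kind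
weight is `c · (#{κ=0} - #{κ=1}) = c`, and `c = ±1` forces `n⁺_ℓ + n⁻_ℓ = 1` for every `ℓ`. (The tree's
`kindWeight_eq_zero_or_weilWord_of_rootDiffWeights` is the case `h ≤ 1` with the `Θ`-balance added, where the second
alternative is a `±`-Weil word.) [cite: MoonenZarhin1999LowDim, Thm. 0.2 (1) with case (e) and §5 (5.3), (5.12)]
[cite: GoodmanWallachGTM255, §4.1.1] -/
theorem kindWeight_eq_zero_or_card_isLeft_eq_and_unit_of_rootDiffWeights (κ : Fin hY → Fin 2) (P : Fin d → Fin hY ⊕ Fin h)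
    (η : Fin d → Fin 2) (hinj : Function.Injective fun t => (P t, η t))
    (hκ : (Finset.univ.filter fun ℓ => κ ℓ = 0).card = (Finset.univ.filter fun ℓ => κ ℓ = 1).card + 1)
    (hD : ∀ i j : Fin hY, ∑ t, Sum.elim (fun ℓ => (if η t = κ ℓ then (1 : ℤ) else -1) *
        ((if ℓ = i then (1 : ℤ) else 0) - (if ℓ = j then (1 : ℤ) else 0))) (fun _ => (0 : ℤ)) (P t) = 0) :
    (∑ t, Sum.elim (fun _ => if η t = 0 then (1 : ℤ) else -1) (fun _ => (0 : ℤ)) (P t) = 0) ∨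
    (Fintype.card {t // (P t).isLeft = true} = hY ∧
      ((∑ t, Sum.elim (fun _ => if η t = 0 then (1 : ℤ) else -1) (fun _ => (0 : ℤ)) (P t) = 1) ∨ (∑ t, Sum.elim (fun _ => if η t = 0 then (1 : ℤ) else -1) (fun _ => (0 : ℤ)) (P t) = -1))) := by
  classical
  -- the signed content `c ℓ` of the pair `ℓ`
  set c : Fin hY → ℤ := fun ℓ => ∑ t, Sum.elim (fun ℓ' => if ℓ' = ℓ then (if η t = κ ℓ' then (1 : ℤ) else -1) else 0)
    (fun _ => (0 : ℤ)) (P t) with hc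
  -- (1) `c i = c j`
  have hcc : ∀ i j, c i = c j := by
    intro i j
    have h := hD i j
    have hsplit : ∀ t, Sum.elim (fun ℓ => (if η t = κ ℓ then (1 : ℤ) else -1) *
        ((if ℓ = i then (1 : ℤ) else 0) - (if ℓ = j then (1 : ℤ) else 0))) (fun _ => (0 : ℤ)) (P t) =
        Sum.elim (fun ℓ' => if ℓ' = i then (if η t = κ ℓ' then (1 : ℤ) else -1) else 0) (fun _ => (0 : ℤ)) (P t) -
        Sum.elim (fun ℓ' => if ℓ' = j then (if η t = κ ℓ' then (1 : ℤ) else -1) else 0) (fun _ => (0 : ℤ)) (P t) := by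
      intro t
      rcases P t with ℓ | e
      · simp only [Sum.elim_inl]
        split_ifs <;> ring
      · simp
    simp only [hsplit, Finset.sum_sub_distrib] at h
    exact sub_eq_zero.1 h
  -- (1') `c ℓ = n⁺_ℓ - n⁻_ℓ` with `n^±_ℓ ≤ 1` the number of `W` / `W^⊥`-members of the pair `ℓ` in the word
  have hcℓ : ∀ ℓ, c ℓ = ((Finset.univ.filter fun t => P t = Sum.inl ℓ ∧ η t = κ ℓ).card : ℤ) -
      ((Finset.univ.filter fun t => P t = Sum.inl ℓ ∧ η t = 1 - κ ℓ).card : ℤ) := by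
    intro ℓ
    rw [hc, Finset.card_filter, Finset.card_filter, Nat.cast_sum, Nat.cast_sum, ← Finset.sum_sub_distrib]
    refine Finset.sum_congr rfl fun t _ => ?_
    rcases hP : P t with ℓ' | e
    · by_cases hℓ : ℓ' = ℓ
      · subst hℓ
        simp only [Sum.elim_inl, if_true, true_and]
        rcases Fin.exists_fin_two.1 ⟨η t, rfl⟩ with h0 | h0 <;>
          rcases Fin.exists_fin_two.1 ⟨κ ℓ', rfl⟩ with k0 | k0 <;> simp [h0, k0]
      · have hne : ¬ (Sum.inl ℓ' : Fin hY ⊕ Fin h) = Sum.inl ℓ := fun h' => hℓ (Sum.inl_injective h')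
        simp [hℓ, hne]
    · simp
  have hn1 : ∀ ℓ, (Finset.univ.filter fun t => P t = Sum.inl ℓ ∧ η t = κ ℓ).card ≤ 1 := fun ℓ =>
    card_filter_place_kind_le_one_shp P η hinj _ _
  have hn2 : ∀ ℓ, (Finset.univ.filter fun t => P t = Sum.inl ℓ ∧ η t = 1 - κ ℓ).card ≤ 1 := fun ℓ =>
    card_filter_place_kind_le_one_shp P η hinj _ _
  -- (1'') the number of letters of the pair `ℓ` is `n⁺_ℓ + n⁻_ℓ`
  have hNℓ : ∀ ℓ, (Finset.univ.filter fun t => P t = Sum.inl ℓ).card =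
      (Finset.univ.filter fun t => P t = Sum.inl ℓ ∧ η t = κ ℓ).card +
        (Finset.univ.filter fun t => P t = Sum.inl ℓ ∧ η t = 1 - κ ℓ).card := by
    intro ℓ
    rw [← Finset.card_filter_add_card_filter_not (s := Finset.univ.filter fun t => P t = Sum.inl ℓ)
      (fun t => η t = κ ℓ), Finset.filter_filter, Finset.filter_filter]
    congr 1
    refine congrArg Finset.card (Finset.filter_congr fun t _ => ?_)
    refine and_congr_right fun _ => ⟨fun hne => fin2_eq_one_sub_of_ne_shp hne, fun h' h'' => ?_⟩
    rw [h''] at h'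
    exact fin2_one_sub_ne_shp (κ ℓ) h'.symm
  -- (2) the `T`-kind weight is `∑_ℓ sgn(κ ℓ) · c ℓ`
  have hKW : ∑ t, Sum.elim (fun _ => if η t = 0 then (1 : ℤ) else -1) (fun _ => (0 : ℤ)) (P t) =
      ∑ ℓ, (if κ ℓ = 0 then (1 : ℤ) else -1) * c ℓ := by
    have hpt : ∀ t, Sum.elim (fun _ => if η t = 0 then (1 : ℤ) else -1) (fun _ => (0 : ℤ)) (P t) =
        ∑ ℓ, (if κ ℓ = 0 then (1 : ℤ) else -1) *
          Sum.elim (fun ℓ' => if ℓ' = ℓ then (if η t = κ ℓ' then (1 : ℤ) else -1) else 0) (fun _ => (0 : ℤ)) (P t) := by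
      intro t
      rcases P t with ℓ₀ | e
      · simp only [Sum.elim_inl, mul_ite, mul_zero, Finset.sum_ite_eq, Finset.mem_univ, if_true]
        rcases Fin.exists_fin_two.1 ⟨η t, rfl⟩ with h0 | h0 <;>
          rcases Fin.exists_fin_two.1 ⟨κ ℓ₀, rfl⟩ with k0 | k0 <;> simp [h0, k0]
      · simp
    simp only [hpt]
    rw [Finset.sum_comm]
    refine Finset.sum_congr rfl fun ℓ _ => ?_
    rw [← Finset.mul_sum]
  -- (3) `∑_ℓ sgn(κ ℓ) = #{κ=0} - #{κ=1} = 1`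
  have hsgn : ∑ ℓ, (if κ ℓ = 0 then (1 : ℤ) else -1) = 1 := by
    rw [sum_kindSign_eq_card_sub_card_shp Finset.univ κ, hκ]; push_cast; ring
  rcases isEmpty_or_nonempty (Fin hY) with hemp | ⟨⟨ℓ₀⟩⟩
  · simp only [Finset.univ_eq_empty, Finset.filter_empty, Finset.card_empty] at hκ
    exact absurd hκ (by omega)
  have hconst : ∀ ℓ, c ℓ = c ℓ₀ := fun ℓ => hcc ℓ ℓ₀
  have hKW' : ∑ t, Sum.elim (fun _ => if η t = 0 then (1 : ℤ) else -1) (fun _ => (0 : ℤ)) (P t) = c ℓ₀ := by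
    rw [hKW]
    calc ∑ ℓ, (if κ ℓ = 0 then (1 : ℤ) else -1) * c ℓ = (∑ ℓ, (if κ ℓ = 0 then (1 : ℤ) else -1)) * c ℓ₀ := by
          rw [Finset.sum_mul]; exact Finset.sum_congr rfl fun ℓ _ => by rw [hconst ℓ]
      _ = c ℓ₀ := by rw [hsgn, one_mul]
  rw [hKW']
  by_cases hzero : c ℓ₀ = 0
  · exact Or.inl hzero
  right
  have hunit : c ℓ₀ = 1 ∨ c ℓ₀ = -1 := by
    have h0 := hcℓ ℓ₀
    have hA₀ := hn1 ℓ₀; have hB₀ := hn2 ℓ₀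
    omega
  refine ⟨?_, hunit⟩
  -- `c = ±1`: every pair carries exactly one letter
  have hN : ∀ ℓ, (Finset.univ.filter fun t => P t = Sum.inl ℓ).card = 1 := by
    intro ℓ
    have h := hcℓ ℓ
    rw [hconst ℓ] at h
    have h0 := hcℓ ℓ₀
    have hA := hn1 ℓ; have hB := hn2 ℓ; have hA₀ := hn1 ℓ₀; have hB₀ := hn2 ℓ₀
    rw [hNℓ ℓ]
    omega
  -- count the `T`-positions pair by pair
  rw [Fintype.card_subtype, Finset.card_eq_sum_card_fiberwise (f := fun t => Sum.elim id (fun _ => ℓ₀) (P t))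
    (t := Finset.univ) (fun _ _ => Finset.mem_univ _)]
  have hfib : ∀ b : Fin hY, ((Finset.univ.filter fun t => (P t).isLeft = true).filter
      fun a => Sum.elim id (fun _ => ℓ₀) (P a) = b) = Finset.univ.filter fun t => P t = Sum.inl b := by
    intro b
    rw [Finset.filter_filter]
    refine Finset.filter_congr fun t _ => ?_
    rcases P t with ℓ | e
    · simp only [Sum.isLeft_inl, Sum.elim_inl, id_eq, true_and, Sum.inl.injEq]
    · simp only [Sum.isLeft_inr, Bool.false_eq_true, Sum.elim_inr, false_and, reduceCtorEq]
  simp only [hfib, hN, Finset.sum_const, Finset.card_univ, Fintype.card_fin, smul_eq_mul, mul_one]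
end Combinatorics

/-! ### §2 The invariance theorem for ONE slot over `T × S` with the sharpened dichotomy -/

section Invariance

variable {Y S X : AbelianVariety ℂ} {g : Fin 1 → (X ⟶ Y.prod S)}


/-- `(i√d)² = -d` (as the rational `d` cast to `ℂ`). [folklore] -/
private theorem I_mul_sqrt_sq_shp (d : ℕ) : (Complex.I * (Real.sqrt d : ℂ)) ^ 2 = -((d : ℚ) : ℂ) := by
  rw [mul_pow, Complex.I_sq, ← Complex.ofReal_pow, Real.sq_sqrt (Nat.cast_nonneg d), Complex.ofReal_natCast,
    Rat.cast_natCast, neg_one_mul]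

/-- `conj(i√d) = -i√d`. [folklore] -/
private theorem conj_I_mul_sqrt_shp (d : ℕ) :
    starRingEnd ℂ (Complex.I * (Real.sqrt d : ℂ)) = -(Complex.I * (Real.sqrt d : ℂ)) := by
  rw [map_mul, Complex.conj_I, Complex.conj_ofReal, neg_mul]

/-- `[a]·x - [b]·x = ([a] - [b]) • x` with an integer scalar. [folklore] -/
private theorem ite_sub_ite_eq_cast_smul_shp {M : Type*} [AddCommGroup M] [Module ℂ M] (a b : Prop) [Decidable a]
    [Decidable b] (x : M) :
    ((if a then x else 0) - (if b then x else 0)) =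
      ((((if a then (1 : ℤ) else 0) - (if b then (1 : ℤ) else 0) : ℤ)) : ℂ) • x := by
  split_ifs <;> simp

set_option maxHeartbeats 800000 in
open scoped Classical in
/-- **The INVARIANCE THEOREM for ONE slot over `T × S`, `T` a threefold of unitary type `(2,1)` over
`End⁰(T) = ℚ(√-d)`, `S` ANY complex abelian variety whose `H¹` has an ABELIAN skew Hodge-commutant** (hypothesis `hSc`:
any two `ψ`-skew rational endomorphisms of `H¹(S(ℂ); ℚ)` commuting with `End_Hdg(H¹ S)` commute — `S` an elliptic
curve with complex multiplication, its square `E × E` (`HOneProduct.mul_comm_of_commute_endAlg_cmCurve_prod_self`),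
any abelian variety of CM type). Moonen–Zarhin 1999 case (e) with (a1), §5 (5.12): «our description of
`Hg(X) ≅ Hg(X₁ × X₂)` in (5.3) above shows that `Hg(X) ⊃ {1} × SU_{F/k}(V₂,ψ)`» — in Lie form: the annihilator of a
Hodge class contains `ι_T 𝔰𝔲_k(H¹T, ψ) π_T` (the tree's R41 Lie step
`Motives/HodgeThetaAnnihilatorUnitaryTimesAbelianCommutant`). Let `T` (here `Y`) be a complex abelian threefold with
`dim_ℚ End⁰(T) = 2`, `φ ≫ φ = -d` (`d > 0`) of multiplicity `1` at `i√d` or at `-i√d`; `X` with ONE slot over `T × S`.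
Then there are Hodge-adapted pair bases of `H¹(T) ⊗ ℂ` and `H¹(S) ⊗ ℂ` such that every rational `(p,p)`-class on `X`
has a letter expansion whose coefficient function VANISHES at every word which is not kind-balanced, or has a
repeated letter, or is neither `T`-kind balanced NOR carries exactly one letter from each of the `dim T` pairs of
`H¹(T)` (so that its number of `T`-positions is `dim T = 3`). Proof: R30's proof (`UnitaryTwoOneTimesCMCurveWeilClasses` §2) verbatim up to the
root-difference weights — the Lie step now fed with `hSc` — then `kindWeight_eq_zero_or_card_isLeft_eq_and_unit_of_rootDiffWeights` (SHARPENED: in the second alternative the `T`-kind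
weight is `±1`, i.e. the `T`-letters are not all of one Hodge type — needed in codimension `3`).
[cite: MoonenZarhin1999LowDim, Thm. 0.2 (1) with case (e) and §5 (5.3), (5.12)] [cite: MoonenZarhin1999LowDim, §2 (2.3) and §3 (3.1)]
[cite: Deligne1982HodgeCycles, I §3 Prop. 3.4] [cite: Lombardo2016, Lemma 3.4 (p. 1229)] [cite: Ribet1983, Thm. 3] -/
theorem AVSlots.exists_coeff_eq_zero_off_balanced_or_unitPair_of_prod_unitaryTwoOne_abelianCommutant
    (hg : AVSlots (Y.prod S) X g)
    (hY3 : Y.dim = 3) (hY2 : Module.finrank ℚ Y.endAlgebra = 2) (φY : Y ⟶ Y) {d : ℕ} (hd : 0 < d)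
    (hφY : φY ≫ φY = -(d • 𝟙 Y))
    (hm1 : eigenMultiplicity Y φY (Complex.I * (Real.sqrt d : ℂ)) = 1 ∨
      eigenMultiplicity Y φY (-(Complex.I * (Real.sqrt d : ℂ))) = 1)
    (hSc : ∀ (ψ₂ : (BettiUniverse.hodge exists_isReal_hodgeModel_holds
        (AbelianVariety.isSmoothProjective_holds (A := S)) 1).Polarization)
      (Z Z' : Module.End ℚ (bettiCohomology S.X 1)),
      (∀ b : ↥(BettiUniverse.hodge exists_isReal_hodgeModel_holds
        (AbelianVariety.isSmoothProjective_holds (A := S)) 1).endAlg,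
        Z * (b : Module.End ℚ (bettiCohomology S.X 1)) = (b : Module.End ℚ (bettiCohomology S.X 1)) * Z) →
      (∀ v w, ψ₂.form (Z v) w + ψ₂.form v (Z w) = 0) →
      (∀ b : ↥(BettiUniverse.hodge exists_isReal_hodgeModel_holds
        (AbelianVariety.isSmoothProjective_holds (A := S)) 1).endAlg,
        Z' * (b : Module.End ℚ (bettiCohomology S.X 1)) = (b : Module.End ℚ (bettiCohomology S.X 1)) * Z') →
      (∀ v w, ψ₂.form (Z' v) w + ψ₂.form v (Z' w) = 0) → Z * Z' = Z' * Z) :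
    ∃ (hA : ℕ) (bA : Module.Basis (Fin hA × Fin 2) ℂ (ℂ ⊗[ℚ] bettiCohomology Y.X 1))
      (h : ℕ) (cC : Module.Basis (Fin h × Fin 2) ℂ (ℂ ⊗[ℚ] bettiCohomology S.X 1)),
      (∀ i, IsOfHodgeType Y.dim Y.X 1 1 0 (ofRatClassBaseChange (Motives.ComplexPoints Y.X) 1 (bA (i, 0)))) ∧
      (∀ i, IsOfHodgeType Y.dim Y.X 1 0 1 (ofRatClassBaseChange (Motives.ComplexPoints Y.X) 1 (bA (i, 1)))) ∧
      (∀ i, IsOfHodgeType S.dim S.X 1 1 0 (ofRatClassBaseChange (Motives.ComplexPoints S.X) 1 (cC (i, 0)))) ∧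
      (∀ i, IsOfHodgeType S.dim S.X 1 0 1 (ofRatClassBaseChange (Motives.ComplexPoints S.X) 1 (cC (i, 1)))) ∧
      ∀ {p : ℕ}, 0 < p → ∀ {c : complexBetti X.X (2 * p)}, IsRationalClass c →
        IsOfHodgeType X.dim X.X (2 * p) p p c →
        ∃ a : (Fin (2 * p) → (Fin 1 × (Fin hA ⊕ Fin h)) × Fin 2) → ℂ,
          wordEval (cupPowOneAlt ℂ (Motives.ComplexPoints X.X) (2 * p))
            (fun jr : (Fin 1 × (Fin hA ⊕ Fin h)) × Fin 2 => complexBetti.map (g jr.1.1).hom.hom.hom 1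
              (Sum.elim
                (fun i => complexBetti.map (Motives.AbelianVariety.fst Y S).hom.hom.hom 1
                  (ofRatClassBaseChange (Motives.ComplexPoints Y.X) 1 (bA (i, jr.2))))
                (fun i => complexBetti.map (Motives.AbelianVariety.snd Y S).hom.hom.hom 1
                  (ofRatClassBaseChange (Motives.ComplexPoints S.X) 1 (cC (i, jr.2))))
                jr.1.2)) a = c ∧
          ∀ (U : Fin (2 * p) → Fin 1 × (Fin hA ⊕ Fin h)) (η : Fin (2 * p) → Fin 2),
            a (fun t => (U t, η t)) ≠ 0 →
            (∀ r : Fin 2, (Finset.univ.filter fun t => η t = r).card = p) ∧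
            Function.Injective (fun t => ((U t).2, η t)) ∧
            ((∑ t, Sum.elim (fun _ : Fin hA => if η t = 0 then (1 : ℤ) else -1) (fun _ : Fin h => (0 : ℤ)) (U t).2 = 0) ∨
             (Fintype.card {t // ((U t).2).isLeft = true} = hA ∧
              ((∑ t, Sum.elim (fun _ : Fin hA => if η t = 0 then (1 : ℤ) else -1) (fun _ : Fin h => (0 : ℤ)) (U t).2 = 1) ∨ (∑ t, Sum.elim (fun _ : Fin hA => if η t = 0 then (1 : ℤ) else -1) (fun _ : Fin h => (0 : ℤ)) (U t).2 = -1)))) := by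
  classical
  -- the setting
  have hHD : exists_isReal_hodgeModel := exists_isReal_hodgeModel_holds
  have hI : hodgePQ_independent_of_hodgeModel := hodgePQ_independent_of_hodgeModel_holds
  haveI : HodgeTensorFacts.{0, 0} := hodgeTensorFacts_holds.{0, 0}
  have hXA : IsSmoothProjective Y.dim Y.X := AbelianVariety.isSmoothProjective_holds
  have hXC : IsSmoothProjective S.dim S.X := AbelianVariety.isSmoothProjective_holds
  have hXP : IsSmoothProjective (Y.prod S).dim (Y.prod S).X := AbelianVariety.isSmoothProjective_holds
  haveI : Module.Finite ℚ (bettiCohomology Y.X 1) := finite_bettiCohomology_one Y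
  haveI : Module.Finite ℚ (bettiCohomology S.X 1) := finite_bettiCohomology_one S
  haveI : Module.Finite ℚ (bettiCohomology (Y.prod S).X 1) := finite_bettiCohomology_one (Y.prod S)
  have hn1 : (((1 : ℕ) : ℤ)) = 1 := by norm_num
  have heffA := BettiUniverse.hodge_isEffective hHD hXA 1
  -- polarizations of `H¹(Y)`, `H¹(S)`
  obtain ⟨ψ⟩ : (BettiUniverse.hodge hHD (AbelianVariety.isSmoothProjective_holds (A := Y)) 1).IsPolarizable :=
    smoothProjective_hodgeStructure_isPolarizable_holds hXA (BettiUniverse.realHodgeModel hHD hXA)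
      (BettiUniverse.realHodgeModel_isHodgeSymmetric hHD hXA) 1
  obtain ⟨ψC⟩ : (BettiUniverse.hodge hHD (AbelianVariety.isSmoothProjective_holds (A := S)) 1).IsPolarizable :=
    smoothProjective_hodgeStructure_isPolarizable_holds hXC (BettiUniverse.realHodgeModel hHD hXC)
      (BettiUniverse.realHodgeModel_isHodgeSymmetric hHD hXC) 1
  -- the unitary data of `H¹(Y)`: `φ^*`, `End_Hdg = ℚ + ℚφ^*`, `μ` with `n''(μ) = 1`, `n'(μ) ≥ 2`
  set φQ : Module.End ℚ (bettiCohomology Y.X 1) := (bettiCohomology.map φY.hom.hom.hom 1).hom with hφQ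
  have hφE : φQ ∈ (BettiUniverse.hodge hHD (AbelianVariety.isSmoothProjective_holds (A := Y)) 1).endAlg :=
    pullback_mem_endAlg hHD hI φY
  have hφ2 : φQ * φQ = -((d : ℚ) • 1) := bettiMapHom_mul_self hφY
  have hdQ : (0 : ℚ) < d := Nat.cast_pos.2 hd
  have hE := exists_eq_smul_one_add_smul_bettiMapHom hHD hI hd hφY hY2 (by omega)
  have hsumm := eigenMultiplicity_add_eigenMultiplicity_neg_eq_dim Y φY hd hφY
  -- `μ` with multiplicity `1` on `H^{0,1}` and `2` on `H^{1,0}`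
  obtain ⟨μ, hμ, hmult1, hmult2'⟩ : ∃ μ : ℂ, μ ^ 2 = -((d : ℚ) : ℂ) ∧
      eigenMultiplicity Y φY (starRingEnd ℂ μ) = 1 ∧ eigenMultiplicity Y φY μ = 2 := by
    rcases hm1 with h | h
    · exact ⟨-(Complex.I * (Real.sqrt d : ℂ)), by rw [neg_sq, I_mul_sqrt_sq_shp],
        by rw [map_neg, conj_I_mul_sqrt_shp, neg_neg, h], by omega⟩
    · exact ⟨Complex.I * (Real.sqrt d : ℂ), I_mul_sqrt_sq_shp d, by rw [conj_I_mul_sqrt_shp, h], by omega⟩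
  have hmult2 : 2 ≤ eigenMultiplicity Y φY μ := hmult2'.ge
  have h1' : Module.finrank ℂ ↥(Module.End.eigenspace (φQ.baseChange ℂ) μ ⊓
      (BettiUniverse.hodge hHD (AbelianVariety.isSmoothProjective_holds (A := Y)) 1).piece 0 1) = 1 := by
    rw [hφQ, finrank_eigenspace_inf_piece_zeroOne_eq_eigenMultiplicity_conj hHD hI φY μ, hmult1]
  have h2' : 2 ≤ Module.finrank ℂ ↥(Module.End.eigenspace (φQ.baseChange ℂ) μ ⊓
      (BettiUniverse.hodge hHD (AbelianVariety.isSmoothProjective_holds (A := Y)) 1).piece 1 0) := by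
    rw [hφQ, finrank_eigenspace_inf_piece_oneZero_eq_eigenMultiplicity hHD hI φY μ]
    exact hmult2
  have h2eq : Module.finrank ℂ ↥(Module.End.eigenspace (φQ.baseChange ℂ) μ ⊓
      (BettiUniverse.hodge hHD (AbelianVariety.isSmoothProjective_holds (A := Y)) 1).piece 1 0) = 2 := by
    rw [hφQ, finrank_eigenspace_inf_piece_oneZero_eq_eigenMultiplicity hHD hI φY μ, hmult2']
  obtain ⟨hμ0, -⟩ := UnitaryTheta.conj_eq_neg_of_sq hdQ hμ
  -- adapted `ψ_ℂ`-dual bases `(e_ℓ, f_ℓ) = (cb (0,ℓ), cb (1,ℓ))` of `H¹(Y) ⊗ ℂ = W ⊕ W'`, kinds `κ`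
  obtain ⟨n₀, cb, κ, hcbW, hcbW', hcb0, hcb1, hdual⟩ := UnitaryTheta.exists_adaptedDualBasis
    (BettiUniverse.hodge hHD (AbelianVariety.isSmoothProjective_holds (A := Y)) 1) Nat.cast_one heffA ψ hφE
    hdQ hφ2 hE hμ
  -- the same basis in PAIR format: `bY (ℓ, r) = cb (if r = κ ℓ then 0 else 1, ℓ)` (`r` = the Hodge kind)
  set τ : Fin n₀ × Fin 2 ≃ Fin 2 × Fin n₀ :=
    { toFun := fun lr => (if lr.2 = κ lr.1 then 0 else 1, lr.1)
      invFun := fun tl => (tl.2, if tl.1 = 0 then κ tl.2 else (if κ tl.2 = 0 then 1 else 0))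
      left_inv := by
        rintro ⟨ℓ, r⟩
        rcases fin2_eq_zero_or_one_shp r with hr | hr <;>
          rcases fin2_eq_zero_or_one_shp (κ ℓ) with hk | hk <;> simp [hr, hk]
      right_inv := by
        rintro ⟨t, ℓ⟩
        rcases fin2_eq_zero_or_one_shp t with ht | ht <;>
          rcases fin2_eq_zero_or_one_shp (κ ℓ) with hk | hk <;> simp [ht, hk] } with hτ
  set bY : Module.Basis (Fin n₀ × Fin 2) ℂ (ℂ ⊗[ℚ] bettiCohomology Y.X 1) := cb.reindex τ.symm with hbYdef
  have hbY : ∀ ℓ r, bY (ℓ, r) = cb (if r = κ ℓ then 0 else 1, ℓ) := fun ℓ r => by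
    rw [hbYdef, Module.Basis.reindex_apply, Equiv.symm_symm]
    rfl
  have hbY0' : ∀ ℓ, bY (ℓ, 0) ∈ (BettiUniverse.hodge hHD hXA 1).piece 1 0 := by
    intro ℓ
    rw [hbY]
    rcases fin2_eq_zero_or_one_shp (κ ℓ) with hk | hk
    · rw [hk, if_pos rfl]; exact (hcb0 ℓ hk).1
    · rw [hk, if_neg (by decide)]; exact (hcb1 ℓ hk).2
  have hbY1' : ∀ ℓ, bY (ℓ, 1) ∈ (BettiUniverse.hodge hHD hXA 1).piece 0 1 := by
    intro ℓ
    rw [hbY]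
    rcases fin2_eq_zero_or_one_shp (κ ℓ) with hk | hk
    · rw [hk, if_neg (by decide)]; exact (hcb0 ℓ hk).2
    · rw [hk, if_pos rfl]; exact (hcb1 ℓ hk).1
  -- the pair basis of `H¹(S) ⊗ ℂ`
  obtain ⟨h, cC, hcC0, hcC1⟩ := exists_hodgeAdapted_pairBasis (BettiUniverse.hodge hHD hXC 1) (by norm_num)
    (BettiUniverse.hodge_isEffective hHD hXC 1)
  have hcC0' : ∀ i, cC (i, 0) ∈ (BettiUniverse.hodge hHD hXC 1).piece 1 0 := fun i => by simpa using hcC0 i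
  have hcC1' : ∀ i, cC (i, 1) ∈ (BettiUniverse.hodge hHD hXC 1).piece 0 1 := fun i => by simpa using hcC1 i
  -- COUNTS: `n₀ = dim Y = 3`, `#{κ = 1} ≤ 1`, `#{κ = 0} ≤ 2`, hence `#{κ = 0} = #{κ = 1} + 1`
  have hn₀ : n₀ = Y.dim := by
    have hcard := Module.finrank_eq_card_basis cb
    rw [Module.finrank_baseChange, finrank_bettiCohomology_one Y, Fintype.card_prod, Fintype.card_fin,
      Fintype.card_fin] at hcard
    omega
  have hκ1 : (Finset.univ.filter fun ℓ => κ ℓ = 1).card ≤ 1 := by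
    set S₀ := Module.End.eigenspace (φQ.baseChange ℂ) μ ⊓
      (BettiUniverse.hodge hHD (AbelianVariety.isSmoothProjective_holds (A := Y)) 1).piece 0 1 with hS₀
    set f : {ℓ : Fin n₀ // κ ℓ = 1} → ↥S₀ := fun ℓ => ⟨cb (0, ℓ.1), hcbW ℓ.1, (hcb1 ℓ.1 ℓ.2).1⟩ with hf
    have hli : LinearIndependent ℂ f := by
      refine LinearIndependent.of_comp S₀.subtype ?_
      have hcomp : ⇑S₀.subtype ∘ f = ⇑cb ∘ fun ℓ : {ℓ : Fin n₀ // κ ℓ = 1} => ((0 : Fin 2), ℓ.1) := by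
        funext ℓ; rfl
      rw [hcomp]
      exact cb.linearIndependent.comp _ fun ℓ ℓ' hll => Subtype.ext (Prod.mk.inj hll).2
    have hle := hli.fintype_card_le_finrank
    rw [Fintype.card_subtype, h1'] at hle
    exact hle
  have hκ0 : (Finset.univ.filter fun ℓ => κ ℓ = 0).card ≤ 2 := by
    set S₀ := Module.End.eigenspace (φQ.baseChange ℂ) μ ⊓
      (BettiUniverse.hodge hHD (AbelianVariety.isSmoothProjective_holds (A := Y)) 1).piece 1 0 with hS₀
    set f : {ℓ : Fin n₀ // κ ℓ = 0} → ↥S₀ := fun ℓ => ⟨cb (0, ℓ.1), hcbW ℓ.1, (hcb0 ℓ.1 ℓ.2).1⟩ with hf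
    have hli : LinearIndependent ℂ f := by
      refine LinearIndependent.of_comp S₀.subtype ?_
      have hcomp : ⇑S₀.subtype ∘ f = ⇑cb ∘ fun ℓ : {ℓ : Fin n₀ // κ ℓ = 0} => ((0 : Fin 2), ℓ.1) := by
        funext ℓ; rfl
      rw [hcomp]
      exact cb.linearIndependent.comp _ fun ℓ ℓ' hll => Subtype.ext (Prod.mk.inj hll).2
    have hle := hli.fintype_card_le_finrank
    rw [Fintype.card_subtype, h2eq] at hle
    exact hle
  have hκsum : (Finset.univ.filter fun ℓ => κ ℓ = 0).card + (Finset.univ.filter fun ℓ => κ ℓ = 1).card = n₀ := by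
    have hneg : (Finset.univ.filter fun ℓ => ¬ κ ℓ = 0) = (Finset.univ.filter fun ℓ => κ ℓ = 1) := by
      refine Finset.filter_congr fun ℓ _ => ?_
      rcases fin2_eq_zero_or_one_shp (κ ℓ) with hk | hk <;> simp [hk]
    rw [← hneg, Finset.card_filter_add_card_filter_not, Finset.card_univ, Fintype.card_fin]
  have hκ : (Finset.univ.filter fun ℓ => κ ℓ = 0).card = (Finset.univ.filter fun ℓ => κ ℓ = 1).card + 1 := by
    omega
  refine ⟨n₀, bY, h, cC, fun i => ?_, fun i => ?_, fun i => ?_, fun i => ?_, ?_⟩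
  · exact (BettiUniverse.mem_hodge_piece_iff hHD hI hXA (k := 1) (p := 1) (q := 0) rfl _).1 (hbY0' i)
  · exact (BettiUniverse.mem_hodge_piece_iff hHD hI hXA (k := 1) (p := 0) (q := 1) rfl _).1 (hbY1' i)
  · exact (BettiUniverse.mem_hodge_piece_iff hHD hI hXC (k := 1) (p := 1) (q := 0) rfl _).1 (hcC0' i)
  · exact (BettiUniverse.mem_hodge_piece_iff hHD hI hXC (k := 1) (p := 0) (q := 1) rfl _).1 (hcC1' i)
  intro p hp c hcQ hc
  -- the presentation `H¹(Y × S) = pr_Y^* H¹(Y) ⊕ pr_E^* H¹(S)` and its complexification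
  set ι₁ := HOneProduct.pullFst Y S with hι₁
  set π₁ := HOneProduct.pullInl Y S with hπ₁
  set ι₂ := HOneProduct.pullSnd Y S with hι₂
  set π₂ := HOneProduct.pullInr Y S with hπ₂
  have hπι₁ : π₁ ∘ₗ ι₁ = LinearMap.id := HOneProduct.pullInl_comp_pullFst
  have hπι₂ : π₂ ∘ₗ ι₂ = LinearMap.id := HOneProduct.pullInr_comp_pullSnd
  have hπ₁ι₂ : π₁ ∘ₗ ι₂ = 0 := HOneProduct.pullInl_comp_pullSnd
  have hπ₂ι₁ : π₂ ∘ₗ ι₁ = 0 := HOneProduct.pullInr_comp_pullFst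
  have hsum : ι₁ ∘ₗ π₁ + ι₂ ∘ₗ π₂ = LinearMap.id := HOneProduct.pullFst_comp_pullInl_add
  have hπι₁C : π₁.baseChange ℂ ∘ₗ ι₁.baseChange ℂ = LinearMap.id := by
    rw [← LinearMap.baseChange_comp, hπι₁, LinearMap.baseChange_id]
  have hπι₂C : π₂.baseChange ℂ ∘ₗ ι₂.baseChange ℂ = LinearMap.id := by
    rw [← LinearMap.baseChange_comp, hπι₂, LinearMap.baseChange_id]
  have hπ₁ι₂C : π₁.baseChange ℂ ∘ₗ ι₂.baseChange ℂ = 0 := by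
    rw [← LinearMap.baseChange_comp, hπ₁ι₂, LinearMap.baseChange_zero]
  have hπ₂ι₁C : π₂.baseChange ℂ ∘ₗ ι₁.baseChange ℂ = 0 := by
    rw [← LinearMap.baseChange_comp, hπ₂ι₁, LinearMap.baseChange_zero]
  have hsumC : ι₁.baseChange ℂ ∘ₗ π₁.baseChange ℂ + ι₂.baseChange ℂ ∘ₗ π₂.baseChange ℂ = LinearMap.id := by
    rw [← LinearMap.baseChange_comp, ← LinearMap.baseChange_comp, ← LinearMap.baseChange_add, hsum,
      LinearMap.baseChange_id]
  have e11 : ∀ x, π₁.baseChange ℂ (ι₁.baseChange ℂ x) = x := fun x => by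
    rw [← LinearMap.comp_apply (f := π₁.baseChange ℂ), hπι₁C, LinearMap.id_apply]
  have e12 : ∀ y, π₁.baseChange ℂ (ι₂.baseChange ℂ y) = 0 := fun y => by
    rw [← LinearMap.comp_apply (f := π₁.baseChange ℂ), hπ₁ι₂C, LinearMap.zero_apply]
  -- piece compatibility of `pr_Y^*`, `pr_E^*`
  have hι₁F : ∀ q : ℤ, ∀ x ∈ (BettiUniverse.hodge hHD hXA 1).piece q (((1 : ℕ) : ℤ) - q),
      ι₁.baseChange ℂ x ∈ (BettiUniverse.hodge hHD hXP 1).piece q (((1 : ℕ) : ℤ) - q) :=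
    fun q x hx => (BettiUniverse.pullHodgeHom hHD hI hXP hXA (Motives.AbelianVariety.fst Y S).hom.hom.hom 1).map_piece_le
      q _ ⟨x, hx, rfl⟩
  have hι₂F : ∀ q : ℤ, ∀ x ∈ (BettiUniverse.hodge hHD hXC 1).piece q (((1 : ℕ) : ℤ) - q),
      ι₂.baseChange ℂ x ∈ (BettiUniverse.hodge hHD hXP 1).piece q (((1 : ℕ) : ℤ) - q) :=
    fun q x hx => (BettiUniverse.pullHodgeHom hHD hI hXP hXC (Motives.AbelianVariety.snd Y S).hom.hom.hom 1).map_piece_le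
      q _ ⟨x, hx, rfl⟩
  -- the basis `cbx` of `H¹(Y × S) ⊗ ℂ` in pairs: `pr_Y^* bY_ℓ^r` and `pr_E^* c_i^r`
  obtain ⟨cbx', hcbx'l, hcbx'r⟩ := exists_basis_of_presentation hπι₁C hπι₂C hπ₁ι₂C hπ₂ι₁C hsumC bY cC
  set cbx : Module.Basis ((Fin n₀ ⊕ Fin h) × Fin 2) ℂ (ℂ ⊗[ℚ] bettiCohomology (Y.prod S).X 1) :=
    cbx'.reindex (Equiv.sumProdDistrib (Fin n₀) (Fin h) (Fin 2)).symm with hcbxdef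
  have hcbx : ∀ tr : (Fin n₀ ⊕ Fin h) × Fin 2, cbx tr =
      Sum.elim (fun i => ι₁.baseChange ℂ (bY (i, tr.2))) (fun i => ι₂.baseChange ℂ (cC (i, tr.2))) tr.1 := by
    rintro ⟨t, r⟩
    rw [hcbxdef, Module.Basis.reindex_apply, Equiv.symm_symm]
    rcases t with i | i
    · rw [Equiv.sumProdDistrib_apply_left, hcbx'l]; rfl
    · rw [Equiv.sumProdDistrib_apply_right, hcbx'r]; rfl
  -- Hodge-adaptedness of `cbx`
  have hcbx0 : ∀ t, cbx (t, 0) ∈ (BettiUniverse.hodge hHD hXP 1).piece 1 0 := by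
    intro t
    rw [hcbx]
    rcases t with i | i
    · have e : (((1 : ℕ) : ℤ) - 1) = 0 := by norm_num
      have h10 := hι₁F 1 _ (by rw [e]; exact hbY0' i)
      rwa [e] at h10
    · have e : (((1 : ℕ) : ℤ) - 1) = 0 := by norm_num
      have h10 := hι₂F 1 _ (by rw [e]; exact hcC0' i)
      rwa [e] at h10
  have hcbx1 : ∀ t, cbx (t, 1) ∈ (BettiUniverse.hodge hHD hXP 1).piece 0 1 := by
    intro t
    rw [hcbx]
    rcases t with i | i
    · have e : (((1 : ℕ) : ℤ) - 0) = 1 := by norm_num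
      have h01 := hι₁F 0 _ (by rw [e]; exact hbY1' i)
      rwa [e] at h01
    · have e : (((1 : ℕ) : ℤ) - 0) = 1 := by norm_num
      have h01 := hι₂F 0 _ (by rw [e]; exact hcC1' i)
      rwa [e] at h01
  -- bases indexed by `Fin M`: the pair basis `cbσ` and the rational basis `eC`
  set eQ := Module.finBasis ℚ (bettiCohomology (Y.prod S).X 1) with heQ
  set eC : Module.Basis (Fin (Module.finrank ℚ (bettiCohomology (Y.prod S).X 1))) ℂ
    (ℂ ⊗[ℚ] bettiCohomology (Y.prod S).X 1) := Algebra.TensorProduct.basis ℂ eQ with heC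
  set φ : Fin (Module.finrank ℚ (bettiCohomology (Y.prod S).X 1)) ≃ (Fin n₀ ⊕ Fin h) × Fin 2 :=
    eC.indexEquiv cbx with hφ
  set cbσ : Module.Basis (Fin (Module.finrank ℚ (bettiCohomology (Y.prod S).X 1))) ℂ
    (ℂ ⊗[ℚ] bettiCohomology (Y.prod S).X 1) := cbx.reindex φ.symm with hcbσdef
  have hcbσ : ∀ m, cbσ m = cbx (φ m) := fun m => by
    rw [hcbσdef, Module.Basis.reindex_apply, Equiv.symm_symm]
  -- letters
  set ρ := ofRatClassBaseChangeEquiv hXP 1 with hρ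
  set v : Module.Basis _ ℂ (complexBetti (Y.prod S).X 1) := cbσ.map ρ with hv
  set eL : Module.Basis _ ℂ (complexBetti (Y.prod S).X 1) := eC.map ρ with heL
  have heLQ : ∀ i, IsRationalClass (eL i) := fun i => by
    rw [heL, Module.Basis.map_apply, heC, Algebra.TensorProduct.basis_apply, hρ,
      ofRatClassBaseChangeEquiv_apply, ofRatClassBaseChange_tmul, one_smul]
    exact isRationalClass_ofRatClass _
  set κ' : Fin (Module.finrank ℚ (bettiCohomology (Y.prod S).X 1)) → Fin 2 := fun m => (φ m).2 with hκ'
  have hv_apply : ∀ m, v m = ofRatClassBaseChange (Motives.ComplexPoints (Y.prod S).X) 1 (cbx (φ m)) := fun m => by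
    rw [hv, Module.Basis.map_apply, hcbσ, hρ, ofRatClassBaseChangeEquiv_apply]
  have hv0 : ∀ m, κ' m = 0 → IsOfHodgeType (Y.prod S).dim (Y.prod S).X 1 1 0 (v m) := by
    intro m hm
    rw [hv_apply, ← BettiUniverse.mem_hodge_piece_iff hHD hI hXP (k := 1) (p := 1) (q := 0) rfl]
    have hsplit : φ m = ((φ m).1, 0) := by
      change (φ m).2 = 0 at hm; rw [← hm]
    rw [hsplit]
    exact hcbx0 _
  have hv1 : ∀ m, κ' m = 1 → IsOfHodgeType (Y.prod S).dim (Y.prod S).X 1 0 1 (v m) := by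
    intro m hm
    rw [hv_apply, ← BettiUniverse.mem_hodge_piece_iff hHD hI hXP (k := 1) (p := 0) (q := 1) rfl]
    have hsplit : φ m = ((φ m).1, 1) := by
      change (φ m).2 = 1 at hm; rw [← hm]
    rw [hsplit]
    exact hcbx1 _
  -- (α) an antisymmetric kind-balanced coefficient function in the adapted letters
  obtain ⟨ax, hax_bal, hax_anti, hcax⟩ := hg.exists_antisymm_kindBalanced_wordEval_eq v κ' hv0 hv1 hp hc
  -- the change of letters to the rational letters
  set G : Matrix _ _ ℂ := eC.toMatrix cbσ with hG
  set G' : Matrix _ _ ℂ := cbσ.toMatrix eC with hG'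
  have hG'G : G' * G = 1 := cbσ.toMatrix_mul_toMatrix_flip eC
  have hve : ∀ m, v m = ∑ i, G i m • eL i := fun m => by
    simp only [hv, heL, Module.Basis.map_apply, ← map_smul, ← map_sum]
    congr 1
    exact (eC.sum_toMatrix_smul_self (v := ⇑cbσ) (j := m)).symm
  have hletters : ∀ j m, avLetters g v (j, m) = ∑ i, G i m • avLetters g eL (j, i) :=
    avLetters_baseChange g G hve
  set aE := colourChangeAt (fun _ : Fin 1 => G) ax with haE
  have haE_anti : IsAntisymm aE := hax_anti.colourChangeAt _
  have hcaE : wordEval (cupPowOneAlt ℂ (Motives.ComplexPoints X.X) (2 * p)) (avLetters g eL) aE = c := by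
    rw [haE, ← wordEval_eq_wordEval_colourChangeAt _ (fun _ : Fin 1 => G) hletters ax, hcax]
  -- rationality of `aE`
  have hFinj : Function.Injective (exteriorPower.alternatingMapLinearEquiv
      (cupPowOneAlt ℂ (Motives.ComplexPoints X.X) (2 * p))) :=
    injective_alternatingMapLinearEquiv_cupPowOneAlt X (2 * p)
  obtain ⟨q, hq⟩ := hg.exists_rat_wordEval_eq eL heLQ hcQ
  obtain ⟨q', -, haEq⟩ := haE_anti.exists_eq_algebraMap_of_wordEval_eq hFinj (hg.letterBasis eL)
    (q := q) (by rw [AVSlots.coe_letterBasis, hcaE, hq])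
  have hslice_e : ∀ u, wordSlice aE u = wordRepAt ℂ (fun _ : Fin (2 * p) => G) (wordSlice ax u) :=
    fun u => wordSlice_colourChangeAt (fun _ : Fin 1 => G) ax u
  -- the Hodge operator `Θ` of `H¹(Y × S)`: `diag(±1)` in the adapted letters
  obtain ⟨Θ, hΘ⟩ := exists_hodgeTheta (BettiUniverse.hodge hHD hXP 1)
  have hΘb : ∀ m, Θ (cbσ m) = (if κ' m = 0 then (1 : ℂ) else -1) • cbσ m := by
    intro m
    rw [hcbσ]
    change Θ _ = (if (φ m).2 = 0 then (1 : ℂ) else -1) • _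
    rcases fin2_eq_zero_or_one_shp (φ m).2 with h0 | h1
    · rw [h0, if_pos rfl]
      have hmem : cbx (φ m) ∈ (BettiUniverse.hodge hHD hXP 1).piece 1 (((1 : ℕ) : ℤ) - 1) := by
        have e : (((1 : ℕ) : ℤ) - 1) = 0 := by norm_num
        have hsplit : φ m = ((φ m).1, 0) := by rw [← h0]
        rw [e, hsplit]; exact hcbx0 _
      rw [hΘ 1 _ hmem]
      norm_num
    · rw [h1, if_neg one_ne_zero]
      have hmem : cbx (φ m) ∈ (BettiUniverse.hodge hHD hXP 1).piece 0 (((1 : ℕ) : ℤ) - 0) := by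
        have e : (((1 : ℕ) : ℤ) - 0) = 1 := by norm_num
        have hsplit : φ m = ((φ m).1, 1) := by rw [← h1]
        rw [e, hsplit]; exact hcbx1 _
      rw [hΘ 0 _ hmem]
      norm_num
  have hΘcb : LinearMap.toMatrix cbσ cbσ Θ = kindDiag κ' := by
    ext i m
    rw [LinearMap.toMatrix_apply, hΘb, map_smul, Module.Basis.repr_self, Finsupp.smul_apply,
      Finsupp.single_apply, kindDiag, Matrix.diagonal_apply, smul_eq_mul, mul_ite, mul_one, mul_zero]
    by_cases him : i = m
    · subst him; rw [if_pos rfl]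
    · rw [if_neg (Ne.symm him), if_neg him]
  have hJG : LinearMap.toMatrix eC eC Θ * G = G * kindDiag κ' := by
    rw [← hΘcb, hG, linearMap_toMatrix_mul_basis_toMatrix, basis_toMatrix_mul_linearMap_toMatrix]
  have hΘq : ∀ u : Fin (2 * p) → Fin 1, wordDerAt ℂ (fun _ : Fin (2 * p) => LinearMap.toMatrix eC eC Θ)
      (wordSlice (fun w => algebraMap ℚ ℂ (q' w)) u) = 0 := by
    intro u
    rw [← haEq, hslice_e]
    refine wordDerAt_wordRepAt_eq_zero_of_mul_eq ℂ (fun _ : Fin (2 * p) => G) (fun _ => hJG) ?_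
    rw [wordDerAt_const]
    exact wordDer_kindDiag_wordSlice_eq_zero κ' hax_bal u
  -- the Hodge operators `Θ_Y`, `Θ_S`
  obtain ⟨ΘA, hΘA⟩ := exists_hodgeTheta (BettiUniverse.hodge hHD hXA 1)
  obtain ⟨ΘC, hΘC⟩ := exists_hodgeTheta (BettiUniverse.hodge hHD hXC 1)
  -- structure of the adapted dual basis for `ψ_ℂ` and `φ_ℂ`
  set Ψ := ψ.form.baseChange ℂ with hΨ
  have hφskewC : ∀ x y, Ψ (φQ.baseChange ℂ x) y + Ψ x (φQ.baseChange ℂ y) = 0 := by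
    haveI : Nontrivial (bettiCohomology Y.X 1) := by
      refine Module.nontrivial_of_finrank_pos (R := ℚ) ?_
      rw [finrank_bettiCohomology_one Y]; omega
    exact ThetaSubalgebra.formBaseChange_add_eq_zero_of_skew ψ
      (UnitaryTheta.form_apply_add_form_apply_eq_zero _ ψ hφE hdQ hφ2 hE)
  have hiso0 : ∀ i j, Ψ (cb (0, i)) (cb (0, j)) = 0 := fun i j =>
    UnitaryTheta.form_eq_zero_of_mem_eigenspace hφskewC hμ0 (hcbW i) (hcbW j)
  have hiso1 : ∀ i j, Ψ (cb (1, i)) (cb (1, j)) = 0 := fun i j =>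
    UnitaryTheta.form_eq_zero_of_mem_eigenspace hφskewC (neg_ne_zero.2 hμ0) (hcbW' i) (hcbW' j)
  have hswap10 : ∀ i j, Ψ (cb (1, i)) (cb (0, j)) = -(if j = i then 1 else 0) := fun i j => by
    rw [hΨ, ψ.form_baseChange_swap, show (((1 : ℕ) : ℤ)).negOnePow = -1 from Int.negOnePow_one, ← hΨ, hdual]
    split_ifs <;> simp
  have hφcb0 : ∀ ℓ, φQ.baseChange ℂ (cb (0, ℓ)) = μ • cb (0, ℓ) := fun ℓ =>
    Module.End.mem_eigenspace_iff.1 (hcbW ℓ)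
  have hφcb1 : ∀ ℓ, φQ.baseChange ℂ (cb (1, ℓ)) = (-μ) • cb (1, ℓ) := fun ℓ =>
    Module.End.mem_eigenspace_iff.1 (hcbW' ℓ)
  -- the elementary operators `P_{ij} ∈ 𝔲_{k'}(H¹Y, ψ)_ℂ ≅ 𝔤𝔩(W)`: `e_j ↦ e_i`, `f_i ↦ -f_j`
  have hops : ∀ i j : Fin n₀, ∃ P : Module.End ℂ (ℂ ⊗[ℚ] bettiCohomology Y.X 1),
      (∀ ℓ, P (cb (0, ℓ)) = if ℓ = j then cb (0, i) else 0) ∧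
      (∀ ℓ, P (cb (1, ℓ)) = if ℓ = i then -cb (1, j) else 0) ∧
      P * φQ.baseChange ℂ = φQ.baseChange ℂ * P ∧ (∀ x y, Ψ (P x) y + Ψ x (P y) = 0) := by
    intro i j
    set P : Module.End ℂ (ℂ ⊗[ℚ] bettiCohomology Y.X 1) := cb.constr ℂ (fun tl : Fin 2 × Fin n₀ =>
      if tl.1 = 0 then (if tl.2 = j then cb (0, i) else 0) else (if tl.2 = i then -cb (1, j) else 0)) with hPdef
    have hP0 : ∀ ℓ, P (cb (0, ℓ)) = if ℓ = j then cb (0, i) else 0 := fun ℓ => by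
      rw [hPdef, Module.Basis.constr_basis]; simp
    have hP1 : ∀ ℓ, P (cb (1, ℓ)) = if ℓ = i then -cb (1, j) else 0 := fun ℓ => by
      rw [hPdef, Module.Basis.constr_basis]; simp
    refine ⟨P, hP0, hP1, ?_, ?_⟩
    · refine cb.ext fun tl => ?_
      obtain ⟨t, ℓ⟩ := tl
      rcases fin2_eq_zero_or_one_shp t with rfl | rfl
      · rw [Module.End.mul_apply, Module.End.mul_apply, hφcb0, map_smul, hP0]
        by_cases hℓ : ℓ = j
        · rw [if_pos hℓ, hφcb0]
        · rw [if_neg hℓ, map_zero, smul_zero]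
      · rw [Module.End.mul_apply, Module.End.mul_apply, hφcb1, map_smul, hP1]
        by_cases hℓ : ℓ = i
        · rw [if_pos hℓ, map_neg, hφcb1, smul_neg]
        · rw [if_neg hℓ, map_zero, smul_zero]
    · have hB : Ψ ∘ₗ P + Ψ.compl₂ P = 0 := by
        refine LinearMap.BilinForm.ext_basis cb fun tk tl => ?_
        obtain ⟨t, k⟩ := tk
        obtain ⟨t', ℓ⟩ := tl
        rw [LinearMap.add_apply, LinearMap.add_apply, LinearMap.comp_apply, LinearMap.compl₂_apply,
          LinearMap.zero_apply, LinearMap.zero_apply]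
        rcases fin2_eq_zero_or_one_shp t with rfl | rfl <;> rcases fin2_eq_zero_or_one_shp t' with rfl | rfl
        · rw [hP0, hP0]
          split_ifs <;> simp [hiso0]
        · rw [hP0, hP1]
          by_cases hk : k = j <;> by_cases hl : ℓ = i
          · subst hk; subst hl; simp [hdual]
          · subst hk; rw [if_pos rfl, if_neg hl, map_zero, add_zero, hdual, if_neg (Ne.symm hl)]
          · subst hl; rw [if_neg hk, if_pos rfl, map_zero, LinearMap.zero_apply, zero_add, map_neg, hdual,
              if_neg hk, neg_zero]
          · rw [if_neg hk, if_neg hl, map_zero, LinearMap.zero_apply, map_zero, add_zero]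
        · rw [hP1, hP0]
          by_cases hk : k = i <;> by_cases hl : ℓ = j
          · subst hk; subst hl; simp [hswap10]
          · subst hk; rw [if_pos rfl, if_neg hl, map_zero, add_zero, map_neg, LinearMap.neg_apply, hswap10,
              if_neg hl, neg_zero, neg_zero]
          · subst hl; rw [if_neg hk, if_pos rfl, map_zero, LinearMap.zero_apply, zero_add, hswap10,
              if_neg (Ne.symm hk), neg_zero]
          · rw [if_neg hk, if_neg hl, map_zero, LinearMap.zero_apply, map_zero, add_zero]
        · rw [hP1, hP1]
          split_ifs <;> simp [hiso1]
      intro x y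
      have h := LinearMap.congr_fun (LinearMap.congr_fun hB x) y
      simpa only [LinearMap.add_apply, LinearMap.comp_apply, LinearMap.compl₂_apply, LinearMap.zero_apply]
        using h
  -- the root differences `D_{ij} = [P_{ij}, P_{ji}] = E_ii - E_jj` (on `W`; `-(E_ii - E_jj)` on `W'`) kill the tensor
  have hYG : ∀ Z : Module.End ℂ (ℂ ⊗[ℚ] bettiCohomology (Y.prod S).X 1), ∀ _t : Fin (2 * p),
      LinearMap.toMatrix eC eC Z * G = G * LinearMap.toMatrix cbσ cbσ Z :=
    fun Z _ => by rw [hG, linearMap_toMatrix_mul_basis_toMatrix, basis_toMatrix_mul_linearMap_toMatrix]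
  -- the diagonal weights of `ι_Y D_{ij} π_Y`: `±([ℓ = i] - [ℓ = j])` at the `Y`-places (sign `+` iff in `W`), `0` at `S`
  set δ : Fin n₀ → Fin n₀ → (Fin n₀ ⊕ Fin h) → Fin 2 → ℤ := fun i j T r =>
    Sum.elim (fun ℓ => (if r = κ ℓ then (1 : ℤ) else -1) * ((if ℓ = i then (1 : ℤ) else 0) - (if ℓ = j then 1 else 0)))
      (fun _ => (0 : ℤ)) T with hδ
  have hax : ∀ i j : Fin n₀, ∀ u : Fin (2 * p) → Fin 1,
      wordDerAt ℂ (fun _ : Fin (2 * p) => blockLift φ (fun T => Matrix.diagonal fun r => ((δ i j T r : ℤ) : ℂ)))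
        (wordSlice ax u) = 0 := by
    intro i j u
    obtain ⟨P, hP0, hP1, hPφ, hPskew⟩ := hops i j
    obtain ⟨P', hP'0, hP'1, hP'φ, hP'skew⟩ := hops j i
    -- `D` is diagonal on `cb`
    have hD0 : ∀ ℓ, (P * P' - P' * P) (cb (0, ℓ)) = (if ℓ = i then cb (0, ℓ) else 0) - (if ℓ = j then cb (0, ℓ) else 0) := by
      intro ℓ
      have hPj : P (cb (0, j)) = cb (0, i) := by rw [hP0, if_pos rfl]
      have hP'i : P' (cb (0, i)) = cb (0, j) := by rw [hP'0, if_pos rfl]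
      rw [LinearMap.sub_apply, Module.End.mul_apply, Module.End.mul_apply, hP'0, hP0]
      by_cases hi : ℓ = i <;> by_cases hj : ℓ = j
      · simp only [if_pos hi, if_pos hj, hPj, hP'i]
        rw [← hi, ← hj]
      · simp only [if_pos hi, if_neg hj, hPj, map_zero]
        rw [hi]
      · simp only [if_neg hi, if_pos hj, hP'i, map_zero]
        rw [hj]
      · simp only [if_neg hi, if_neg hj, map_zero, sub_self]
    have hD1 : ∀ ℓ, (P * P' - P' * P) (cb (1, ℓ)) = (if ℓ = j then cb (1, ℓ) else 0) - (if ℓ = i then cb (1, ℓ) else 0) := by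
      intro ℓ
      have hPi : P (cb (1, i)) = -cb (1, j) := by rw [hP1, if_pos rfl]
      have hP'j : P' (cb (1, j)) = -cb (1, i) := by rw [hP'1, if_pos rfl]
      have hPi' : P (-cb (1, i)) = cb (1, j) := by rw [map_neg P (cb (1, i)), hPi, neg_neg]
      have hP'j' : P' (-cb (1, j)) = cb (1, i) := by rw [map_neg P' (cb (1, j)), hP'j, neg_neg]
      rw [LinearMap.sub_apply, Module.End.mul_apply, Module.End.mul_apply, hP'1, hP1]
      by_cases hi : ℓ = i <;> by_cases hj : ℓ = j
      · simp only [if_pos hi, if_pos hj, hPi', hP'j']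
        rw [← hi, ← hj]
      · simp only [if_pos hi, if_neg hj, map_zero, hP'j']
        rw [hi]
      · simp only [if_neg hi, if_pos hj, hPi', map_zero]
        rw [hj]
      · simp only [if_neg hi, if_neg hj, map_zero, sub_self]
    have hDbY : ∀ ℓ r, (P * P' - P' * P) (bY (ℓ, r)) = ((δ i j (Sum.inl ℓ) r : ℤ) : ℂ) • bY (ℓ, r) := by
      intro ℓ r
      rw [hbY]
      by_cases hr : r = κ ℓ
      · rw [if_pos hr, hD0, ite_sub_ite_eq_cast_smul_shp]
        congr 2
        simp only [hδ, Sum.elim_inl, if_pos hr]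
        ring
      · rw [if_neg hr, hD1, ite_sub_ite_eq_cast_smul_shp]
        congr 2
        simp only [hδ, Sum.elim_inl, if_neg hr]
        ring
    -- the Lie step: `ι_Y D π_Y` kills the rational coefficient tensor
    have hL : wordDerAt ℂ (fun _ : Fin (2 * p) => LinearMap.toMatrix eC eC
          (ι₁.baseChange ℂ ∘ₗ (P * P' - P' * P) ∘ₗ π₁.baseChange ℂ))
        (wordSlice (fun w => algebraMap ℚ ℂ (q' w)) u) = 0 :=
      wordDerAt_incl_bracket_proj_eq_zero_of_unitary_times_abelianCommutant hn1 (BettiUniverse.hodge hHD hXP 1)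
        (BettiUniverse.hodge hHD hXA 1) (BettiUniverse.hodge hHD hXC 1) heffA hπι₁ hπι₂ hπ₁ι₂ hπ₂ι₁ hsum hι₁F hι₂F ψ
        ψC hφE hdQ hφ2 hE hμ h1' h2' (hSc ψC) eQ q' hΘ hΘA hΘC hΘq hPφ hPskew hP'φ hP'skew u
    -- the matrix of `Z` in the pair letters is the diagonal block family
    have hblk : LinearMap.toMatrix cbσ cbσ (ι₁.baseChange ℂ ∘ₗ (P * P' - P' * P) ∘ₗ π₁.baseChange ℂ) =
        blockLift φ (fun T => Matrix.diagonal fun r => ((δ i j T r : ℤ) : ℂ)) := by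
      refine toMatrix_eq_blockLift_of_apply_basis φ cbσ _ _ fun m => ?_
      rw [hcbσ m]
      have hb' : ∀ a, cbσ (φ.symm ((φ m).1, a)) = cbx ((φ m).1, a) := fun a => by
        rw [hcbσ, Equiv.apply_symm_apply]
      simp only [hb']
      obtain ⟨T, r⟩ := φ m
      rw [Finset.sum_eq_single r]
      · rw [Matrix.diagonal_apply_eq]
        rcases T with ℓ | e
        · simp only [hcbx, Sum.elim_inl]
          rw [LinearMap.comp_apply, LinearMap.comp_apply, e11, hDbY, map_smul]
        · simp only [hcbx, Sum.elim_inr]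
          rw [LinearMap.comp_apply, LinearMap.comp_apply, e12, map_zero, map_zero]
          have h0 : ((δ i j (Sum.inr e) r : ℤ) : ℂ) = 0 := by simp only [hδ, Sum.elim_inr, Int.cast_zero]
          rw [h0, zero_smul]
      · intro a _ ha
        simp only [Matrix.diagonal_apply_ne _ ha, zero_smul]
      · intro hr; exact absurd (Finset.mem_univ r) hr
    have hLu := hL
    rw [← haEq, hslice_e] at hLu
    have h3 : wordRepAt ℂ (fun _ : Fin (2 * p) => G)
        (wordDerAt ℂ (fun _ : Fin (2 * p) => blockLift φ (fun T => Matrix.diagonal fun r => ((δ i j T r : ℤ) : ℂ)))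
          (wordSlice ax u)) = 0 := by
      rw [← hblk, wordRepAt_wordDerAt_of_mul_eq ℂ (fun _ : Fin (2 * p) => G) (hYG _), hLu]
    exact wordRepAt_injective ℂ (g := fun _ : Fin (2 * p) => G) (g' := fun _ : Fin (2 * p) => G')
      (funext fun _ => hG'G) (by rw [h3, map_zero])
  -- the coefficient function, refined to slot-and-place colours
  refine ⟨placeRefine φ ax, ?_, fun U η hU => ?_⟩
  · rw [← hcax]
    have hx : (fun jr : (Fin 1 × (Fin n₀ ⊕ Fin h)) × Fin 2 => avLetters g v (jr.1.1, φ.symm (jr.1.2, jr.2))) =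
        fun jr : (Fin 1 × (Fin n₀ ⊕ Fin h)) × Fin 2 => complexBetti.map (g jr.1.1).hom.hom.hom 1
          (Sum.elim
            (fun i => complexBetti.map (Motives.AbelianVariety.fst Y S).hom.hom.hom 1
              (ofRatClassBaseChange (Motives.ComplexPoints Y.X) 1 (bY (i, jr.2))))
            (fun i => complexBetti.map (Motives.AbelianVariety.snd Y S).hom.hom.hom 1
              (ofRatClassBaseChange (Motives.ComplexPoints S.X) 1 (cC (i, jr.2))))
            jr.1.2) := by
      funext jr
      rw [avLetters_apply, hv_apply, Equiv.apply_symm_apply, hcbx]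
      obtain ⟨⟨j, t⟩, r⟩ := jr
      rcases t with i | i
      · simp only [Sum.elim_inl]
        congr 1
        rw [hι₁, ← ofRatClassBaseChangeEquiv_apply (hX := hXP), ← ofRatClassBaseChangeEquiv_apply (hX := hXA),
          complexBetti_map_ofRatClassBaseChangeEquiv hXP hXA]
      · simp only [Sum.elim_inr]
        congr 1
        rw [hι₂, ← ofRatClassBaseChangeEquiv_apply (hX := hXP), ← ofRatClassBaseChangeEquiv_apply (hX := hXC),
          complexBetti_map_ofRatClassBaseChangeEquiv hXP hXC]
    rw [← hx]
    exact wordEval_placeRefine _ φ (avLetters g v) ax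
  · -- words with a repeated letter: antisymmetry
    have hanti' : IsAntisymm (placeRefine φ ax) := fun σ w =>
      hax_anti σ (fun t => ((w t).1.1, φ.symm ((w t).1.2, (w t).2)))
    have hinjw : Function.Injective (fun t => (U t, η t)) := by
      by_contra hni
      exact hU (hanti'.apply_eq_zero_of_not_injective hni)
    -- injectivity of the place-and-kind word (ONE slot)
    have hinjP : Function.Injective fun t => ((U t).2, η t) := by
      intro t t' htt
      simp only [Prod.mk.injEq] at htt
      refine hinjw ?_
      simp only [Prod.mk.injEq]
      exact ⟨Prod.ext (Subsingleton.elim _ _) htt.1, htt.2⟩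
    -- `Θ`-balance: the kind counts
    have hval : placeRefine φ ax (fun t => (U t, η t)) = ax (fun t => ((U t).1, φ.symm ((U t).2, η t))) := rfl
    have hbal := hax_bal _ (by rw [← hval]; exact hU)
    have hcnt : ∀ r : Fin 2, (Finset.univ.filter fun t => η t = r).card = p := by
      intro r
      have hb := hbal r
      simp only [wordContent, hκ', Equiv.apply_symm_apply] at hb
      exact hb
    refine ⟨hcnt, hinjP, ?_⟩
    -- root-difference weights
    have hDw : ∀ i j : Fin n₀, ∑ t, Sum.elim (fun ℓ => (if η t = κ ℓ then (1 : ℤ) else -1) *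
        ((if ℓ = i then (1 : ℤ) else 0) - (if ℓ = j then (1 : ℤ) else 0))) (fun _ => (0 : ℤ)) (U t).2 = 0 := by
      intro i j
      have h2 : wordDerAt ℂ (fun t => Matrix.diagonal fun r => ((δ i j (U t).2 r : ℤ) : ℂ))
          (wordSlice (placeRefine φ ax) U) = 0 :=
        wordDerAt_placeFamily_placeRefine_eq_zero φ (fun T => Matrix.diagonal fun r => ((δ i j T r : ℤ) : ℂ)) (hax i j) U
      by_contra hw
      refine hU (eq_zero_of_wordDerAt_diagonal_eq_zero (fun t r => ((δ i j (U t).2 r : ℤ) : ℂ)) h2 η ?_)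
      rw [← Int.cast_sum, Int.cast_ne_zero]
      simpa only [hδ] using hw
    -- the dichotomy
    exact kindWeight_eq_zero_or_card_isLeft_eq_and_unit_of_rootDiffWeights κ (fun t => (U t).2) η hinjP hκ hDw

end Invariance



end Literature.AlgebraicGeometry.HodgeTheory

end
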